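import Mathlib.Algebra.Homology.HomologicalComplexLimits
import Mathlib.Algebra.Category.ModuleCat.Biproducts
import Mathlib.Algebra.Category.ModuleCat.Limits
import Mathlib.CategoryTheory.Preadditive.Biproducts
import Mathlib.Algebra.Homology.Additive
import Literature.AlgebraicTopology.SingularHomology.ClopenAdditivity
import Literature.AlgebraicTopology.SingularHomology.SingularCochains
import HarnessLib

/-!
# Additivity of singular cohomology over a finite clopen partition

A. Hatcher, *Algebraic Topology* (2002), §3.1, p. 202: for a disjoint union the inclusions induce
"an isomorphism `Hⁿ(∐_α X_α; G) ≈ ∏_α Hⁿ(X_α; G)`" (dual to Prop. 2.6 / the additivity axiom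
of §2.3 for homology). The tree has the two-summand case `Hⁿ(X ⊕ Y; M) ≃ₗ Hⁿ(X; M) × Hⁿ(Y; M)`
(`DisjointUnion.lean`, `singularCohomology.sumEquiv`) and, for HOMOLOGY, the case of an arbitrary
clopen partition `Z = ⊔ₖ A k` (`ClopenAdditivity.lean`, `IsClopenPartition`,
`singularHomology.clopenPartitionEquiv`). This file proves the COHOMOLOGY statement for a
**finite** clopen partition (finite, so that the product is a biproduct and no completeness of
the coefficient category beyond finite sums is used):

* `singularCochainComplex.pieceLift`, `pieceLift_f_bijective`, `pieceIso` — the cochain map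
  `φ ↦ (incl_k^♯ φ)ₖ : C(Z) ⟶ ⨁ₖ C(↥(A k))` is an isomorphism of cochain complexes: a cochain is
  determined by its restrictions to the pieces (every singular simplex lies in one piece,
  `IsClopenPartition.color`, since its image is preconnected) and any family of cochains on the
  pieces glues (`gluePieces`);
* `singularCohomology.pieceInH` (the "extension by zero" `Hⁿ(↥(A k)) → Hⁿ(Z)`) with
  `pieceInH_map_self` (`incl_k^* ∘ pieceInH k = 𝟙`), `pieceInH_map_of_ne` (`incl_j^* ∘ pieceInH k
  = 0`, `j ≠ k`), `sum_map_pieceInH` (`∑ₖ pieceInH k ∘ incl_k^* = 𝟙`);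
* **`singularCohomology.clopenPartitionPiEquiv h n : Hⁿ(Z; M) ≃ₗ[R] ∏ₖ Hⁿ(↥(A k); M)`**,
  `z ↦ (incl_k^* z)ₖ` (`pieceMapPi_bijective`), with the element-level corollaries
  `eq_zero_iff_forall_map_subsetIncl` and `existsUnique_forall_map_subsetIncl_eq`.

Written for the Betti realisation of a variety over a number field regarded over `ℚ`
(`Literature/AlgebraicGeometry/Motives/RestrictScalarsPoints.lean`: `W|_ℚ(ℂ)` is the finite clopen
union of the conjugates `W_σ(ℂ)`, so `Hⁱ(W|_ℚ(ℂ); ℚ) ≅ ∏_σ Hⁱ(W_σ(ℂ); ℚ)`; Deninger–Scholl 1991,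
§4.1), in the provefact seat of
`Literature.NumberTheory.EllipticCurves.ModularForms.nonempty_schollBettiRealisation`.
Everything is proved; no named facts (D-0014). Mathlib (pin) has no finite-biproduct instance for
categories of complexes (only binary biproducts, `HomologicalComplexBiprod`); it is obtained here
as a LOCAL instance from finite products (`HasFiniteBiproducts.of_hasFiniteProducts`, complexes of
modules being complete, `HomologicalComplexLimits`), and the additivity of
`HomologicalComplex.homologyFunctor` / `HomologicalComplex.eval` (`Functor.map_sum`) is used to
pass sums through homology and through degrees.

## References

* A. Hatcher, *Algebraic Topology*, CUP 2002, §3.1 p. 202; Prop. 2.6 and §2.3 (additivity).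
  [HatcherAT2002]
* C. Deninger, A. J. Scholl, *The Beilinson conjectures*, LMS LNS 153 (1991), §4.1 (the
  application). [DeningerScholl1991]
-/

noncomputable section

open CategoryTheory Limits Set Function

universe u v w

namespace Literature.AlgebraicTopology.SingularHomology

variable (R : Type v) [CommRing R] (M : Type v) [AddCommGroup M] [Module R M]
variable {Z : Type u} [TopologicalSpace Z] {ι : Type w} {A : ι → Set Z}

/-- Cochain complexes of `R`-modules have finite biproducts (they have finite products, being
complete — Mathlib `HomologicalComplexLimits` — and form a preadditive category; Mathlib
`HasFiniteBiproducts.of_hasFiniteProducts`). Used as a LOCAL instance in this file only.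
[folklore] -/
theorem hasFiniteBiproducts_cochainComplex :
    HasFiniteBiproducts (CochainComplex (ModuleCat.{max u v} R) ℕ) :=
  HasFiniteBiproducts.of_hasFiniteProducts

attribute [local instance] hasFiniteBiproducts_cochainComplex

/-! ### Elements of finite biproducts of complexes of modules -/

section Biproduct

variable {R}
variable {J : Type w} [Finite J] (C : J → CochainComplex (ModuleCat.{max u v} R) ℕ)

/-- `∑ₖ πₖ ≫ ιₖ = 𝟙` for a finite biproduct (Mathlib's `biproduct.total`, restated for an index
type in an arbitrary universe). [folklore] -/
lemma biproduct_total [Fintype J] : ∑ k, biproduct.π C k ≫ biproduct.ι C k = 𝟙 (⨁ C) := by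
  classical
  refine biproduct.hom_ext _ _ fun j => ?_
  rw [Preadditive.sum_comp, Category.id_comp, Finset.sum_eq_single j]
  · rw [Category.assoc, biproduct.ι_π_self, Category.comp_id]
  · intro k _ hkj
    rw [Category.assoc, biproduct.ι_π_ne _ hkj, comp_zero]
  · intro hj
    exact absurd (Finset.mem_univ j) hj

/-- An element of a degree of a finite biproduct of complexes is the sum of the images of its
projections. [folklore] -/
lemma biproduct_decomp [Fintype J] (i : ℕ) (y : (⨁ C).X i) :
    ∑ k, (biproduct.ι C k).f i ((biproduct.π C k).f i y) = y := by
  have h : ∑ k, biproduct.π C k ≫ biproduct.ι C k = 𝟙 (⨁ C) := biproduct_total C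
  have h' : ∑ k, (biproduct.π C k ≫ biproduct.ι C k).f i = 𝟙 ((⨁ C).X i) := by
    have hs := map_sum (HomologicalComplex.Hom.fAddMonoidHom (C₁ := ⨁ C) (C₂ := ⨁ C) i)
      (fun k => biproduct.π C k ≫ biproduct.ι C k) Finset.univ
    rw [h] at hs
    exact hs.symm
  have h'' := congrArg (fun φ : (⨁ C).X i ⟶ (⨁ C).X i => φ y) h'
  have e : ((∑ k, (biproduct.π C k ≫ biproduct.ι C k).f i : (⨁ C).X i ⟶ _)) y =
      ∑ k, (biproduct.ι C k).f i ((biproduct.π C k).f i y) := by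
    change (∑ k, (biproduct.π C k ≫ biproduct.ι C k).f i).hom y = _
    rw [ModuleCat.hom_sum, LinearMap.coe_sum, Finset.sum_apply]
    rfl
  exact e.symm.trans h''

/-- Two elements of a degree of a finite biproduct of complexes with the same projections are
equal. [folklore] -/
lemma biproductX_ext [Fintype J] {i : ℕ} {y y' : (⨁ C).X i}
    (h : ∀ k, (biproduct.π C k).f i y = (biproduct.π C k).f i y') : y = y' := by
  rw [← biproduct_decomp C i y, ← biproduct_decomp C i y']
  exact Finset.sum_congr rfl fun k _ => by rw [h k]

end Biproduct

/-! ### Restricting cochains to the pieces -/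

namespace singularCochainComplex

open SingularSimplex

variable {R M} {n : ℕ}

section Glue

variable (h : IsClopenPartition A)
include h

/-- A cochain of `Z` is determined by its restrictions to the pieces of a clopen partition (every
simplex lies in a piece). [folklore] -/
lemma ext_of_map_subsetIncl {φ ψ : (singularCochainComplex R M Z).X n}
    (hφψ : ∀ k, (singularCochainComplex.map R M (subsetIncl (A k))).f n φ =
      (singularCochainComplex.map R M (subsetIncl (A k))).f n ψ) :
    φ = ψ := by
  refine singularCochainComplex.ext fun σ => ?_
  have e := congrFun (hφψ (h.color σ)) (σ.codRestrict (A (h.color σ)) (h.range_subset_color σ))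
  rwa [singularCochainComplex.map_apply, singularCochainComplex.map_apply,
    codRestrict_map_val] at e

/-- The cochain of `Z` glued from cochains on the pieces: on a simplex `σ`, the value of the
cochain of the piece containing `σ`. [folklore] -/
def gluePieces {N : Type v} (φ : ∀ k, SingularSimplex (A k) n → N) : SingularSimplex Z n → N :=
  fun σ => φ (h.color σ) (σ.codRestrict (A (h.color σ)) (h.range_subset_color σ))

/-- The glued cochain restricts to `φ k` on the piece `A k`. [folklore] -/
lemma gluePieces_map_subsetIncl {N : Type v} (φ : ∀ k, SingularSimplex (A k) n → N) (k : ι)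
    (τ : SingularSimplex (A k) n) :
    gluePieces h φ (τ.map (subsetIncl (A k))) = φ k τ := by
  have key : ∀ (k' : ι) (hk : (τ.map (subsetIncl (A k))).range ⊆ A k'), k' = k →
      φ k' ((τ.map (subsetIncl (A k))).codRestrict (A k') hk) = φ k τ := by
    intro k' hk e
    subst e
    rw [show (τ.map (subsetIncl (A _))).codRestrict (A _) hk = τ from
      map_injective Subtype.val_injective (codRestrict_map_val _ _ hk)]
  exact key _ _ (h.color_map_subsetIncl k τ)

end Glue

variable [Fintype ι]

variable (R M A) in
/-- The cochain map `φ ↦ (incl_k^♯ φ)_k : C(Z) ⟶ ⨁ₖ C(↥(A k))` (Hatcher 2002, §3.1 p. 202,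
`Hⁿ(∐ X_α; G) ≅ ∏ Hⁿ(X_α; G)`, at cochain level). [cite: HatcherAT2002, §3.1 p. 202] -/
def pieceLift :
    singularCochainComplex R M Z ⟶ ⨁ fun k => singularCochainComplex R M (A k) :=
  biproduct.lift fun k => singularCochainComplex.map R M (subsetIncl (A k))

/-- `pieceLift ≫ π_k = incl_k^♯`. [folklore] -/
@[reassoc (attr := simp)]
lemma pieceLift_π (k : ι) :
    pieceLift R M A ≫ biproduct.π (fun k => singularCochainComplex R M (A k)) k =
      singularCochainComplex.map R M (subsetIncl (A k)) :=
  biproduct.lift_π _ _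

/-- The `k`-th component of `pieceLift φ` is the restriction of `φ` to `A k`. [folklore] -/
lemma pieceLift_f_π (k : ι) (φ : (singularCochainComplex R M Z).X n) :
    (biproduct.π (fun k => singularCochainComplex R M (A k)) k).f n ((pieceLift R M A).f n φ) =
      (singularCochainComplex.map R M (subsetIncl (A k))).f n φ := by
  rw [← ModuleCat.comp_apply, ← HomologicalComplex.comp_f, pieceLift_π]

variable (h : IsClopenPartition A)
include h

/-- **`φ ↦ (incl_k^♯ φ)_k` is bijective in each degree** for a finite clopen partition: injective
because a cochain is determined by its restrictions, surjective by gluing. [folklore] -/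
theorem pieceLift_f_bijective (n : ℕ) : Function.Bijective ((pieceLift R M A).f n) := by
  constructor
  · intro φ ψ e
    exact ext_of_map_subsetIncl h fun k => by rw [← pieceLift_f_π, ← pieceLift_f_π, e]
  · intro y
    refine ⟨gluePieces h fun k =>
      (biproduct.π (fun k => singularCochainComplex R M (A k)) k).f n y, ?_⟩
    refine biproductX_ext _ fun k => ?_
    rw [pieceLift_f_π]
    funext τ
    rw [singularCochainComplex.map_apply, gluePieces_map_subsetIncl]

/-- **`C(Z) ≅ ⨁ₖ C(↥(A k))`** as cochain complexes, for a finite clopen partition (Hatcher 2002,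
§3.1, p. 202). [cite: HatcherAT2002, §3.1 p. 202] -/
theorem isIso_pieceLift : IsIso (pieceLift R M A) := by
  haveI : ∀ n, IsIso ((pieceLift R M A).f n) := fun n =>
    (ConcreteCategory.isIso_iff_bijective _).2 (pieceLift_f_bijective h n)
  exact HomologicalComplex.Hom.isIso_of_components _

/-- The isomorphism of cochain complexes `C(Z) ≅ ⨁ₖ C(↥(A k))`. [folklore] -/
def pieceIso : singularCochainComplex R M Z ≅ ⨁ fun k => singularCochainComplex R M (A k) :=
  haveI := isIso_pieceLift (R := R) (M := M) h
  asIso (pieceLift R M A)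

/-- `pieceIso ≫ π_k = incl_k^♯`. [folklore] -/
@[reassoc (attr := simp)]
lemma pieceIso_hom_π (k : ι) :
    (pieceIso (R := R) (M := M) h).hom ≫ biproduct.π (fun k => singularCochainComplex R M (A k)) k =
      singularCochainComplex.map R M (subsetIncl (A k)) :=
  biproduct.lift_π _ _

end singularCochainComplex

/-! ### Additivity of cohomology -/

namespace singularCohomology

open SingularSimplex

variable {R M} [Fintype ι] (h : IsClopenPartition A)
include h

/-- The inclusion `Hⁿ(↥(A k)) → Hⁿ(Z)` of the `k`-th factor (through `C(Z) ≅ ⨁ₖ C(↥(A k))`;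
"extension by zero" of classes on a clopen piece). [folklore] -/
def pieceInH (k : ι) (n : ℕ) : singularCohomology R M (A k) n ⟶ singularCohomology R M Z n :=
  HomologicalComplex.homologyMap
    (biproduct.ι (fun k => singularCochainComplex R M (A k)) k ≫
      (singularCochainComplex.pieceIso (R := R) (M := M) h).inv) n

/-- `incl_k^* ∘ pieceInH k = 𝟙` on `Hⁿ(↥(A k))`. [folklore] -/
@[reassoc (attr := simp)]
lemma pieceInH_map_self (k : ι) (n : ℕ) :
    pieceInH h k n ≫ map R M (subsetIncl (A k)) n = 𝟙 (singularCohomology R M (A k) n) := by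
  change _ ≫ HomologicalComplex.homologyMap _ n = 𝟙 ((singularCochainComplex R M (A k)).homology n)
  rw [pieceInH, ← singularCochainComplex.pieceIso_hom_π h, ← HomologicalComplex.homologyMap_comp,
    Category.assoc, Iso.inv_hom_id_assoc, biproduct.ι_π_self, HomologicalComplex.homologyMap_id]

/-- `incl_j^* ∘ pieceInH k = 0` for `j ≠ k`. [folklore] -/
lemma pieceInH_map_of_ne {j k : ι} (hjk : k ≠ j) (n : ℕ) :
    pieceInH h k n ≫ map R M (subsetIncl (A j)) n = 0 := by
  change _ ≫ HomologicalComplex.homologyMap _ n = (0 : (singularCochainComplex R M (A k)).homology n ⟶ _)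
  rw [pieceInH, ← singularCochainComplex.pieceIso_hom_π h, ← HomologicalComplex.homologyMap_comp,
    Category.assoc, Iso.inv_hom_id_assoc, biproduct.ι_π_ne _ hjk, HomologicalComplex.homologyMap_zero]

/-- `∑ₖ incl_k^* ≫ pieceInH k = 𝟙` on `Hⁿ(Z)`. [folklore] -/
lemma sum_map_pieceInH (n : ℕ) :
    ∑ k, map R M (subsetIncl (A k)) n ≫ pieceInH h k n = 𝟙 (singularCohomology R M Z n) := by
  have key : ∑ k, ((singularCochainComplex.pieceIso (R := R) (M := M) h).hom ≫
      biproduct.π (fun k => singularCochainComplex R M (A k)) k) ≫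
      (biproduct.ι (fun k => singularCochainComplex R M (A k)) k ≫
        (singularCochainComplex.pieceIso (R := R) (M := M) h).inv) = 𝟙 _ := by
    simp only [Category.assoc]
    rw [← Preadditive.comp_sum]
    simp only [← Category.assoc]
    rw [← Preadditive.sum_comp, biproduct_total, Category.id_comp, Iso.hom_inv_id]
  have hs := (HomologicalComplex.homologyFunctor (ModuleCat.{max u v} R) (ComplexShape.up ℕ) n).map_sum
    (fun k => ((singularCochainComplex.pieceIso (R := R) (M := M) h).hom ≫
      biproduct.π (fun k => singularCochainComplex R M (A k)) k) ≫
      (biproduct.ι (fun k => singularCochainComplex R M (A k)) k ≫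
        (singularCochainComplex.pieceIso (R := R) (M := M) h).inv)) Finset.univ
  rw [key] at hs
  simp only [HomologicalComplex.homologyFunctor_map, HomologicalComplex.homologyMap_id,
    HomologicalComplex.homologyMap_comp] at hs
  -- `hs : 𝟙 _ = ∑ k, (homologyMap (iso.hom) ≫ homologyMap (π k)) ≫ homologyMap (ι k) ≫ homologyMap iso.inv`
  change ∑ k, map R M (subsetIncl (A k)) n ≫ pieceInH h k n =
    𝟙 ((singularCochainComplex R M Z).homology n)
  rw [hs]
  refine Finset.sum_congr rfl fun k _ => ?_
  change HomologicalComplex.homologyMap _ n ≫ HomologicalComplex.homologyMap _ n = _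
  rw [← singularCochainComplex.pieceIso_hom_π h, HomologicalComplex.homologyMap_comp,
    HomologicalComplex.homologyMap_comp]

variable (R M A) in
omit [Fintype ι] h in
/-- The additivity map `Hⁿ(Z; M) →ₗ[R] ∏ₖ Hⁿ(↥(A k); M)`, `z ↦ (incl_k^* z)ₖ` (Hatcher 2002, §3.1,
p. 202). [cite: HatcherAT2002, §3.1 p. 202] -/
def pieceMapPi (n : ℕ) :
    singularCohomology R M Z n →ₗ[R] (∀ k, singularCohomology R M (A k) n) :=
  LinearMap.pi fun k => (singularCohomology.map R M (subsetIncl (A k)) n).hom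

omit [Fintype ι] h in
/-- `pieceMapPi z k = incl_k^* z`. [folklore] -/
@[simp]
lemma pieceMapPi_apply (n : ℕ) (z : singularCohomology R M Z n) (k : ι) :
    pieceMapPi R M A n z k = singularCohomology.map R M (subsetIncl (A k)) n z :=
  rfl

/-- Evaluating `∑ₖ incl_k^* ≫ pieceInH k = 𝟙` at a class. [folklore] -/
lemma sum_pieceInH_map_apply (n : ℕ) (z : singularCohomology R M Z n) :
    ∑ k, pieceInH h k n (singularCohomology.map R M (subsetIncl (A k)) n z) = z := by
  have htot := congrArg (fun φ : singularCohomology R M Z n ⟶ singularCohomology R M Z n => φ z)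
    (sum_map_pieceInH h n)
  simp only [ModuleCat.id_apply] at htot
  refine Eq.trans ?_ htot
  change _ = (∑ k, singularCohomology.map R M (subsetIncl (A k)) n ≫ pieceInH h k n).hom z
  rw [ModuleCat.hom_sum, LinearMap.coe_sum, Finset.sum_apply]
  rfl

/-- **Additivity of singular cohomology over a finite clopen partition**: `z ↦ (incl_k^* z)ₖ` is
bijective (Hatcher 2002, §3.1, p. 202: `Hⁿ(∐_α X_α; G) ≅ ∏_α Hⁿ(X_α; G)`, for a finite
decomposition into disjoint open pieces). [cite: HatcherAT2002, §3.1 p. 202] -/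
theorem pieceMapPi_bijective (n : ℕ) : Function.Bijective (pieceMapPi R M A n) := by
  classical
  constructor
  · rw [injective_iff_map_eq_zero]
    intro z hz
    rw [← sum_pieceInH_map_apply h n z]
    refine Finset.sum_eq_zero fun k _ => ?_
    have hk := congrFun hz k
    rw [pieceMapPi_apply, Pi.zero_apply] at hk
    change pieceInH h k n (singularCohomology.map R M (subsetIncl (A k)) n z) = 0
    rw [hk, map_zero]
  · intro x
    refine ⟨∑ k, pieceInH h k n (x k), ?_⟩
    funext j
    rw [pieceMapPi_apply, map_sum, Finset.sum_eq_single j]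
    · rw [← ModuleCat.comp_apply, pieceInH_map_self, ModuleCat.id_apply]
    · intro k _ hkj
      rw [← ModuleCat.comp_apply, pieceInH_map_of_ne h hkj]
      rfl
    · intro hj
      exact absurd (Finset.mem_univ j) hj

/-- **`Hⁿ(Z; M) ≃ₗ[R] ∏ₖ Hⁿ(↥(A k); M)`**, `z ↦ (incl_k^* z)ₖ`, for a finite clopen partition
`Z = ⊔ₖ A k` (Hatcher 2002, §3.1, p. 202). [cite: HatcherAT2002, §3.1 p. 202] -/
def clopenPartitionPiEquiv (n : ℕ) :
    singularCohomology R M Z n ≃ₗ[R] (∀ k, singularCohomology R M (A k) n) :=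
  LinearEquiv.ofBijective (pieceMapPi R M A n) (pieceMapPi_bijective h n)

/-- `clopenPartitionPiEquiv z k = incl_k^* z`. [folklore] -/
@[simp]
lemma clopenPartitionPiEquiv_apply (n : ℕ) (z : singularCohomology R M Z n) (k : ι) :
    clopenPartitionPiEquiv h n z k = singularCohomology.map R M (subsetIncl (A k)) n z :=
  rfl

/-- A class of `Hⁿ(Z)` vanishes iff its restrictions to all pieces vanish. [folklore] -/
theorem eq_zero_iff_forall_map_subsetIncl (n : ℕ) (z : singularCohomology R M Z n) :
    z = 0 ↔ ∀ k, singularCohomology.map R M (subsetIncl (A k)) n z = 0 := by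
  rw [← (clopenPartitionPiEquiv h n).map_eq_zero_iff, funext_iff]
  simp only [clopenPartitionPiEquiv_apply, Pi.zero_apply]

/-- Classes on the pieces glue uniquely: for every family `(x_k)` of classes on the pieces there
is a unique class on `Z` restricting to each `x_k`. [folklore] -/
theorem existsUnique_forall_map_subsetIncl_eq (n : ℕ) (x : ∀ k, singularCohomology R M (A k) n) :
    ∃! z : singularCohomology R M Z n, ∀ k, singularCohomology.map R M (subsetIncl (A k)) n z = x k := by
  refine ⟨(clopenPartitionPiEquiv h n).symm x, fun k => ?_, fun z hz => ?_⟩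
  · rw [← clopenPartitionPiEquiv_apply h, LinearEquiv.apply_symm_apply]
  · apply (clopenPartitionPiEquiv h n).injective
    rw [LinearEquiv.apply_symm_apply]
    funext k
    rw [clopenPartitionPiEquiv_apply, hz k]

end singularCohomology

end Literature.AlgebraicTopology.SingularHomology

end
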